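import Summits.QuantumAdvantage.QuantumAdvantage.Theorems.WalkThreeStepProfile

/-!
# Rung (G♯₂) `ThreeStepFreeRungFive` (item stmt-QuantumAdvantage-23286), architecture (U), module U-d 1/3: the F₄ REGISTER and the
# TRACE FORMULA

Cell qa-qnc0, route OddPrimeWalk, support item stmt-QuantumAdvantage-23286 (planner qa-qnc0-p2 g27, ROUND-27 §2/§3.5, ask P2-27a);
prover qn-prover-3 g16.

The u-walk game in `F₄`-bookkeeping (ROUND-27 §2 TRACE FORMULA): with `ζ` a primitive cube root of unity in `F₄` and
`Tr(y) = y + y²`, the liveness indicator is `[T ≢ 0 (mod 3)] = Tr(ζ^T)`, so for ANY strategy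
`WIN(u) = Tr(ζ^{c+W} · Ŵ(u))`, `Ŵ(u) := Σ_g J_g(u) ζ^{g + N(g)}` (`J_g` = fire bit, `N(g) = wtPrefix u g`, `W = wt u`).
To keep everything `decide`-able we hand-roll `F₄` as the additive group `F4 := ZMod 2 × ZMod 2` (coordinates on the basis `ζ, ζ²`;
`1 = ζ + ζ² = (1,1)`), multiplication by `ζ^m` as `rotZ m` (`m : ZMod 3`), `ζ^T` as `unitZ T`, and the functional `y ↦ Tr(ζ^T y)` as
`evZ T` (§1, all identities by `decide`).  §2: the register `reg S x = Σ_g term S x g` of a three-step strategy and the trace formula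
`ringWinU_iff_ev`; per-term transport lemmas (`term_congr`, `term_shift`).  Sequel: `WalkThreeStepSymmetry` (degeneracy ⇒ the register
is symmetric in the bits of a degenerate interval), `WalkThreeStepThreeWeights` (the three-weights law, module U-d).
WHAT THIS IS NOT: bookkeeping only; separation NOT moved.
-/

namespace Summit.QuantumAdvantage.AdviceFreeQNC0.LocalEngine

open Finset Classical

namespace RungU

/-! ### §1 `F₄` on `ZMod 2 × ZMod 2` -/

/-- `F₄` as an additive group: `(x₁, x₂) ↔ x₁ ζ + x₂ ζ²`. -/
abbrev F4 : Type := ZMod 2 × ZMod 2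

/-- multiplication by `ζ^m`, `m : ZMod 3` (`ζ · (x₁ζ + x₂ζ²) = x₂ ζ + (x₁ + x₂) ζ²`). -/
def rotZ (m : ZMod 3) (y : F4) : F4 :=
  if m = 0 then y else if m = 1 then (y.2, y.1 + y.2) else (y.1 + y.2, y.1)

/-- the element `ζ^l`, `l : ZMod 3` (`ζ⁰ = 1 = (1,1)`). -/
def unitZ (l : ZMod 3) : F4 := rotZ l (1, 1)

/-- the functional `y ↦ Tr(ζ^t · y)` (values in `ZMod 2`). -/
def evZ (t : ZMod 3) (y : F4) : ZMod 2 :=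
  if t = 0 then y.1 + y.2 else if t = 1 then y.1 else y.2

/-- `ζ^a ζ^b = ζ^{a+b}` on the module. -/
theorem rotZ_add (a b : ZMod 3) (y : F4) : rotZ (a + b) y = rotZ a (rotZ b y) := by
  revert a b y; decide

/-- `ζ^0 = id`. -/
theorem rotZ_zero (y : F4) : rotZ 0 y = y := by
  revert y; decide

/-- `ζ^m · 0 = 0`. -/
theorem rotZ_map_zero (m : ZMod 3) : rotZ m 0 = 0 := by
  revert m; decide

/-- `ζ^m (a + b) = ζ^m a + ζ^m b`. -/
theorem rotZ_map_add (m : ZMod 3) (a b : F4) : rotZ m (a + b) = rotZ m a + rotZ m b := by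
  revert m a b; decide

/-- `ζ^{l+m} = ζ^m ζ^l`. -/
theorem unitZ_add (l m : ZMod 3) : unitZ (l + m) = rotZ m (unitZ l) := by
  revert l m; decide

/-- `Tr(ζ^t · 0) = 0`. -/
theorem evZ_map_zero (t : ZMod 3) : evZ t 0 = 0 := by
  revert t; decide

/-- `Tr(ζ^t (a + b)) = Tr(ζ^t a) + Tr(ζ^t b)`. -/
theorem evZ_map_add (t : ZMod 3) (a b : F4) : evZ t (a + b) = evZ t a + evZ t b := by
  revert t a b; decide

/-- **`[t + l ≢ 0] = Tr(ζ^{t+l})`**: `evZ t (unitZ l) = [t + l ≠ 0]`. -/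
theorem evZ_unitZ (t l : ZMod 3) : evZ t (unitZ l) = if t + l = 0 then 0 else 1 := by
  revert t l; decide

/-- `Tr(ζ^{t+m} ζ^m y) = Tr(ζ^{t+2m} y)`… in the form we need: shifting the register by `ζ^m` shifts the functional: -/
theorem evZ_rotZ (t m : ZMod 3) (y : F4) : evZ t (rotZ m y) = evZ (t + m) y := by
  revert t m y; decide

/-- **Trace injectivity**: if `Tr(ζ^t y) = 0` for all three `t`, then `y = 0`. -/
theorem eq_zero_of_evZ (y : F4) (h : ∀ t : ZMod 3, evZ t y = 0) : y = 0 := by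
  revert y; decide

/-- `1 + ζ^m + ζ^{2m} = 0` for `m ≠ 0`: `y + ζ^m y + ζ^{m+m} y = 0`. -/
theorem rotZ_three_sum (m : ZMod 3) (hm : m ≠ 0) (y : F4) : y + rotZ m y + rotZ (m + m) y = 0 := by
  revert m y; decide

/-- `ζ^m` as an additive monoid hom (for `map_sum`). -/
def rotHom (m : ZMod 3) : F4 →+ F4 where
  toFun := rotZ m
  map_zero' := rotZ_map_zero m
  map_add' := rotZ_map_add m

/-- `Tr(ζ^t ·)` as an additive monoid hom (for `map_sum`). -/
def evHom (t : ZMod 3) : F4 →+ ZMod 2 where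
  toFun := evZ t
  map_zero' := evZ_map_zero t
  map_add' := evZ_map_add t

/-- `ζ^m` commutes with finite sums. -/
theorem rotZ_sum {ι : Type*} (s : Finset ι) (f : ι → F4) (m : ZMod 3) :
    rotZ m (∑ i ∈ s, f i) = ∑ i ∈ s, rotZ m (f i) := map_sum (rotHom m) f s

/-- `Tr(ζ^t ·)` commutes with finite sums. -/
theorem evZ_sum {ι : Type*} (s : Finset ι) (f : ι → F4) (t : ZMod 3) :
    evZ t (∑ i ∈ s, f i) = ∑ i ∈ s, evZ t (f i) := map_sum (evHom t) f s

/-- characteristic two: `y + y = 0` in `F4`. -/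
theorem F4_add_self (y : F4) : y + y = 0 := by
  revert y; decide

/-! ### §2 The register of a three-step strategy and the trace formula -/

variable {p n : ℕ}

/-- the contribution of cut `g` on input `x`: `J_g(x) · ζ^{g + N(g)}`. -/
noncomputable def term (S : ThreeStep p n) (x : Fin n → Bool) (g : Fin (n + 1)) : F4 :=
  if S.y g x = true then unitZ ((g.val + wtPrefix x g.val : ℕ) : ZMod 3) else 0

/-- the register `Ŵ(x) = Σ_g J_g(x) ζ^{g + N(g)}`. -/
noncomputable def reg (S : ThreeStep p n) (x : Fin n → Bool) : F4 := ∑ g : Fin (n + 1), term S x g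

/-- the evaluated term is the status bit. -/
theorem evZ_term (c : ℕ) (S : ThreeStep p n) (x : Fin n → Bool) (g : Fin (n + 1)) :
    evZ ((c + wt x : ℕ) : ZMod 3) (term S x g) = ((status3 c S g x).toNat : ZMod 2) := by
  unfold term status3
  by_cases hJ : S.y g x = true
  · rw [if_pos hJ, evZ_unitZ, hJ, Bool.true_and]
    have e : (((c + wt x : ℕ) : ZMod 3) + ((g.val + wtPrefix x g.val : ℕ) : ZMod 3) = 0)
        ↔ (c + g.val + walkExp x g.val) % 3 = 0 := by
      rw [← Nat.cast_add, ZMod.natCast_eq_zero_iff, Nat.dvd_iff_mod_eq_zero]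
      unfold walkExp
      constructor <;> intro h <;> omega
    by_cases h0 : (c + g.val + walkExp x g.val) % 3 = 0
    · rw [if_pos (e.mpr h0)]
      simp [h0]
    · rw [if_neg (fun h => h0 (e.mp h))]
      simp [h0]
  · rw [if_neg hJ]
    rw [evZ_map_zero]
    simp [hJ]

/-- **TRACE FORMULA**: `WIN(x) = Tr(ζ^{c + W} Ŵ(x))`. -/
theorem ringWinU_iff_ev (c : ℕ) (S : ThreeStep p n) (x : Fin n → Bool) :
    ringWinU c S.y x = true ↔ evZ ((c + wt x : ℕ) : ZMod 3) (reg S x) = 1 := by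
  rw [ringWinU_eq_true_iff_odd_sum3]
  unfold reg
  rw [evZ_sum]
  rw [Finset.sum_congr rfl (fun g _ => evZ_term c S x g), ← Nat.cast_sum, ZMod.natCast_eq_one_iff_odd]

/-- WIN as a `ZMod 2` value: `[WIN] = Tr(ζ^{c+W} Ŵ)`. -/
theorem win_toNat_eq_ev (c : ℕ) (S : ThreeStep p n) (x : Fin n → Bool) :
    (((ringWinU c S.y x).toNat : ℕ) : ZMod 2) = evZ ((c + wt x : ℕ) : ZMod 3) (reg S x) := by
  by_cases h : ringWinU c S.y x = true
  · rw [h, (ringWinU_iff_ev c S x).mp h]; simp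
  · have h1 : evZ ((c + wt x : ℕ) : ZMod 3) (reg S x) ≠ 1 := fun h' => h ((ringWinU_iff_ev c S x).mpr h')
    have h2 : evZ ((c + wt x : ℕ) : ZMod 3) (reg S x) = 0 := by
      have : ∀ z : ZMod 2, z ≠ 1 → z = 0 := by decide
      exact this _ h1
    rw [h2]
    simp [h]

/-- terms are decided by the fire bit and the prefix count. -/
theorem term_congr (S : ThreeStep p n) {x x' : Fin n → Bool} (g : Fin (n + 1))
    (hJ : S.y g x = S.y g x') (hN : wtPrefix x g.val = wtPrefix x' g.val) : term S x g = term S x' g := by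
  unfold term
  rw [hJ, hN]

/-- **label shift**: same fire bit, prefix count larger by `m` ⇒ the term is multiplied by `ζ^m`. -/
theorem term_shift (S : ThreeStep p n) {x x' : Fin n → Bool} (g : Fin (n + 1)) (m : ℕ)
    (hJ : S.y g x' = S.y g x) (hN : wtPrefix x' g.val = wtPrefix x g.val + m) :
    term S x' g = rotZ (m : ZMod 3) (term S x g) := by
  unfold term
  rw [hJ, hN]
  by_cases h : S.y g x = true
  · rw [if_pos h, if_pos h, ← unitZ_add]
    congr 1
    push_cast
    ring
  · rw [if_neg h, if_neg h, rotZ_map_zero]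

/-- the fire bit of a three-step cut is decided by the residues `mod p` of `N` at its two reads and of `W`. -/
theorem y_congr_of_mod (S : ThreeStep p n) (g : Fin (n + 1)) {x x' : Fin n → Bool}
    (h1 : wtPrefix x (S.s g) % p = wtPrefix x' (S.s g) % p)
    (h2 : wtPrefix x (max (S.s g) (S.t g)) % p = wtPrefix x' (max (S.s g) (S.t g)) % p)
    (h3 : wt x % p = wt x' % p) : S.y g x = S.y g x' := by
  rw [ThreeStep.y_eq_decide, ThreeStep.y_eq_decide, (ZMod.natCast_eq_natCast_iff' _ _ _).mpr h1,
    (ZMod.natCast_eq_natCast_iff' _ _ _).mpr h2, (ZMod.natCast_eq_natCast_iff' _ _ _).mpr h3]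

end RungU

end Summit.QuantumAdvantage.AdviceFreeQNC0.LocalEngine
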